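import Summits.BirchSwinnertonDyer.BirchSwinnertonDyer.Theorems.KimAtThreeDeepLowerOffStratumLevelLoweringMultiStabDepleteRows
import Summits.BirchSwinnertonDyer.BirchSwinnertonDyer.Theorems.KimAtThreeDeepLowerOffStratumLevelLoweringMultiStabRowsRamClass
import Literature.NumberTheory.EllipticCurves.LevelLoweringGamma0AtThreeAdditiveDrop
import Literature.NumberTheory.EllipticCurves.ModularDegreeQuadraticTwistProofs
import HarnessLib

/-!
# Route `KimAtThreeKolyvagin` (rung W2), crux `DeepLowerAtThreeOffKatoStratum` (item 19679), registered
# stub `stub_nonAdditive`: the CLASS «(ram), ordinary-if-good, `v₃(∏ c_ℓ) = 1` at a multiplicative prime, every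
# additive place of Kodaira type `IV`/`IV*` has `f = 2`» — the DROP rows — WITHOUT row data

Cell `bsd-addord`, seat `bsd-addord-w2-acc2`, gen 7; item `stmt-BirchSwinnertonDyer-19679` (`--supports`, closes
nothing). ROAD (b^k,add) file 4 = the class twin of ★⁹ (`…MultiStabDepleteRows`): the Tamagawa-`3` prime `q`,
the unramified multiplicative set `D`, the DROPPING additive set `A` (the places with `3 ∣ #Φ_v(𝔽̄_v)`) and the
optimal level `M₁ = N/(D·A·q)` are CONSTRUCTED from the curve, and the newform is the named fact
`ribet1990_levelLowering_gamma0_newform_at_three_additiveDrop`. Class conditions beyond ★⁸'s: «`3 ∤ c_p` at every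
additive `p`» (the Tamagawa `3` sits at a multiplicative prime) replaces «no `IV`/`IV*` place», and «`p³ ∤ N` at
every additive place with `3 ∣ #Φ_p(𝔽̄_p)`» (`f_p = 2`, so `a_p(g) = ±1 ≠ 0` and Vatsal's Condition 1 survives the
depletion; automatic for `p ≥ 5`). Theorems only; nothing booked; BSD is not proved by any of this.

* §1 `exists_split_prime_of_three_dvd_tamagawaProduct_of_not_dvd_additive`, `exists_dropSet` (the squarefree product
  `A` of the additive places with `3 ∣ #Φ`).
* §2 ★¹⁰ `stub_nonAdditive_ram_tamagawaDepthOne_of_drop`.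
[cite: DarmonDiamondTaylor1995, Thm. 3.15, Lemma 2.7] [cite: SilvermanATAEC1994, Cor. IV.9.2, Table 4.1, §IV.10, Prop. 10.3]
[cite: Skinner2016PacificMC, Thm. C (§1)] [cite: Vatsal1999, §1 (1.6), Thm. (1.13)] [cite: Ribet1984ICM, Thm. 4.1]
-/

set_option autoImplicit false
-- the Theorems namespace of a single-conjunct summit repeats the summit name by design (D-0017)
set_option linter.dupNamespace false

noncomputable section

open scoped MatrixGroups ModularForm Classical NNReal NumberField

open CongruenceSubgroup WeierstrassCurve Literature.NumberTheory.EllipticCurves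
  Literature.NumberTheory.EllipticCurves.ModularForms IsDedekindDomain NumberField Rat.HeightOneSpectrum

namespace Summit.BirchSwinnertonDyer.BirchSwinnertonDyer.Theorems.KimAtThreeDeepLowerOffStratumLevelLoweringMultiStabDepleteRowsClass

open Summit.BirchSwinnertonDyer.BirchSwinnertonDyer.Theorems.KimAtThreeDeepLowerOffStratumLevelLoweringMultiStabDepleteRows
open Summit.BirchSwinnertonDyer.BirchSwinnertonDyer.Theorems.KimAtThreeDeepLowerOffStratumLevelLoweringMultiStabRowsRamClass
  (exists_decomposition_exactlyDividing)
open Summit.BirchSwinnertonDyer.BirchSwinnertonDyer.Theorems.KimAtThreeDeepLowerOffStratumLevelLoweringMultiStabRowsClass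
  (split_and_three_dvd_of_three_dvd_localTamagawaNumber)
open Summit.BirchSwinnertonDyer.BirchSwinnertonDyer.Theorems.KimAtThreeShallowEqDeepOffStratumNonAdditiveRows
  (not_sq_dvd_conductorNorm_of_not_addv)
open Literature.NumberTheory.EllipticCurves.Rank1Residual Literature.NumberTheory.EllipticCurves.Rank1Residual.Typed
  Literature.NumberTheory.EllipticCurves.Skinner2016 Literature.NumberTheory.Automorphic

/-! ### §1 The Tamagawa-`3` prime and the dropping additive set -/

section Data

variable (W : WeierstrassCurve ℚ) [W.IsElliptic] [W.IsGloballyMinimal]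

/-- **The Tamagawa-`3` prime when `3 ∤ c_p` at the additive primes**: if `3 ∣ ∏_ℓ c_ℓ(E)` and `3 ∤ c_p` at every
prime `p` with `p² ∣ N`, some prime `q ∥ N` has SPLIT multiplicative reduction with `3 ∣ ord_q(Δ_min)`.
[cite: SilvermanATAEC1994, Cor. IV.9.2 (d), IV.9.4 Step 2, Thm. IV.10.2] [cite: SilvermanAEC2009, Thm. VII.6.1] -/
theorem exists_split_prime_of_three_dvd_tamagawaProduct_of_not_dvd_additive (h3 : 3 ∣ W.tamagawaProduct)
    (hK : ∀ (p : ℕ) (hp : p.Prime), p ^ 2 ∣ W.conductorNorm ℤ →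
      ¬ 3 ∣ (haveI := Fact.mk hp; (W.baseChange ℚ_[p]).localTamagawaNumber ℤ_[p])) :
    ∃ (q : ℕ) (_ : Fact q.Prime), q ∣ W.conductorNorm ℤ ∧ ¬ q ^ 2 ∣ W.conductorNorm ℤ ∧
      W.HasSplitMultiplicativeReductionAtPrime q ∧ (3 : ℤ) ∣ padicValRat q W.Δ := by
  have hfW : (W.badPlaces ℤ).Finite := W.finite_badPlaces_holds ℤ
  set s : Finset (HeightOneSpectrum ℤ) := hfW.toFinset with hsdef
  have hsW : ∀ w, ¬ W.HasGoodReductionAt w → w ∈ s := fun w hw ↦ by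
    rw [hsdef, Set.Finite.mem_toFinset, mem_badPlaces_iff]; exact hw
  rw [tamagawaProduct_eq_prod W s hsW] at h3
  obtain ⟨v, hv, hdv⟩ := Nat.prime_three.prime.exists_mem_finset_dvd h3
  haveI := Fact.mk (primesEquiv v).2
  have hbad : ¬ W.HasGoodReductionAt v := by
    rw [hsdef, Set.Finite.mem_toFinset, mem_badPlaces_iff] at hv; exact hv
  have hbad' : ¬ W.HasGoodReductionAtPrime (primesEquiv v : ℕ) := fun hgood ↦
    hbad ((WeierstrassCurve.hasGoodReductionAtPrime_primesEquiv_iff_hasGoodReductionAt W v).mp hgood)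
  have hmultv : W.HasMultiplicativeReductionAt v := by
    rcases hasGoodReductionAt_or_hasMultiplicativeReductionAt_or_hasAdditiveReductionAt v W with hg | hm | ha
    · exact absurd hg hbad
    · exact hm
    · have h2 : (primesEquiv v : ℕ) ^ 2 ∣ W.conductorNorm ℤ := (natGenerator_sq_dvd_conductorNorm_iff v W).mpr ha
      exact absurd hdv (hK _ (primesEquiv v).2 h2)
  have hmult : W.HasMultiplicativeReductionAtPrime (primesEquiv v : ℕ) :=
    (hasMultiplicativeReductionAtPrime_primesEquiv_iff_hasMultiplicativeReductionAt W v).mpr hmultv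
  have hN : (primesEquiv v : ℕ) ∣ W.conductorNorm ℤ := by
    by_contra h
    exact hbad' (hasGoodReductionAtPrime_of_not_dvd_conductorNorm W h)
  have hN2 : ¬ (primesEquiv v : ℕ) ^ 2 ∣ W.conductorNorm ℤ := by
    change ¬ natGenerator v ^ 2 ∣ W.conductorNorm ℤ
    rw [natGenerator_sq_dvd_conductorNorm_iff v W]
    exact hmultv.not_hasAdditiveReductionAt
  obtain ⟨hs, hord⟩ := split_and_three_dvd_of_three_dvd_localTamagawaNumber W (primesEquiv v : ℕ) hmult hdv
  exact ⟨(primesEquiv v : ℕ), inferInstance, hN, hN2, hs, hord⟩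

omit [W.IsGloballyMinimal] in
/-- **The dropping additive set `A`**: the product of the primes `p_v` over the places `v` of additive reduction with
`3 ∣ #Φ_v(𝔽̄_v)` (Kodaira type `IV`/`IV*`) is squarefree, its primes are additive (`p² ∣ N`), and at an additive place
`3 ∣ #Φ_v(𝔽̄_v)` iff `p_v ∣ A`. [cite: SilvermanATAEC1994, Table 4.1 and Thm. IV.10.2 (c)] -/
theorem exists_dropSet :
    ∃ A : ℕ, Squarefree A ∧ (∀ p : ℕ, p.Prime → p ∣ A → p ^ 2 ∣ W.conductorNorm ℤ) ∧
      (∀ v : HeightOneSpectrum ℤ, W.HasAdditiveReductionAt v →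
        (3 ∣ (W.kodairaSymbolAt v).componentGroupOrder ↔ natGenerator v ∣ A)) ∧
      (∀ n : ℕ, (∀ p : ℕ, p.Prime → p ∣ A → p ∣ n) → A ∣ n) := by
  have hfW : (W.badPlaces ℤ).Finite := W.finite_badPlaces_holds ℤ
  set S : Finset (HeightOneSpectrum ℤ) :=
    hfW.toFinset.filter (fun v ↦ W.HasAdditiveReductionAt v ∧ 3 ∣ (W.kodairaSymbolAt v).componentGroupOrder) with hS
  have hmemS : ∀ v, v ∈ S ↔ W.HasAdditiveReductionAt v ∧ 3 ∣ (W.kodairaSymbolAt v).componentGroupOrder := by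
    intro v
    rw [hS, Finset.mem_filter, Set.Finite.mem_toFinset, mem_badPlaces_iff]
    exact ⟨fun h ↦ h.2, fun h ↦ ⟨h.1.not_hasGoodReductionAt, h⟩⟩
  -- a prime dividing a product of the `p_w` is one of them
  have hdvd : ∀ (T : Finset (HeightOneSpectrum ℤ)) (p : ℕ), p.Prime → p ∣ ∏ w ∈ T, natGenerator w →
      ∃ w ∈ T, p = natGenerator w := by
    intro T p hp hpT
    obtain ⟨w, hw, hpw⟩ := hp.prime.exists_mem_finset_dvd hpT
    exact ⟨w, hw, (Nat.prime_dvd_prime_iff_eq hp (prime_natGenerator w)).mp hpw⟩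
  have hinj : ∀ v w : HeightOneSpectrum ℤ, natGenerator v = natGenerator w → v = w :=
    fun v w h ↦ (primesEquiv (R := ℤ)).injective (Subtype.ext h)
  -- squarefree, by induction on the finset
  have hsq : ∀ T : Finset (HeightOneSpectrum ℤ), Squarefree (∏ w ∈ T, natGenerator w) := by
    intro T
    induction T using Finset.induction_on with
    | empty => rw [Finset.prod_empty]; exact squarefree_one
    | insert v T hvT ih =>
      rw [Finset.prod_insert hvT]
      refine Nat.squarefree_mul_iff.mpr ⟨?_, (prime_natGenerator v).squarefree, ih⟩
      refine (Nat.Prime.coprime_iff_not_dvd (prime_natGenerator v)).mpr fun h ↦ ?_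
      obtain ⟨w, hw, hvw⟩ := hdvd T _ (prime_natGenerator v) h
      exact hvT (hinj v w hvw ▸ hw)
  refine ⟨∏ w ∈ S, natGenerator w, hsq S, fun p hp hpA ↦ ?_, fun v hadd ↦ ⟨fun h3 ↦ ?_, fun h ↦ ?_⟩, fun n hn ↦ ?_⟩
  · obtain ⟨w, hw, rfl⟩ := hdvd S p hp hpA
    exact (natGenerator_sq_dvd_conductorNorm_iff w W).mpr ((hmemS w).mp hw).1
  · exact Finset.dvd_prod_of_mem (fun w ↦ natGenerator w) ((hmemS v).mpr ⟨hadd, h3⟩)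
  · obtain ⟨w, hw, hvw⟩ := hdvd S _ (prime_natGenerator v) h
    rw [hinj v w hvw]
    exact ((hmemS w).mp hw).2
  · -- a product of DISTINCT primes each dividing `n` divides `n`
    rw [← Finset.prod_image (s := S) (g := natGenerator) (f := fun p : ℕ ↦ p) fun v _ w _ h ↦ hinj v w h]
    refine Finset.prod_primes_dvd n (fun p hp ↦ ?_) fun p hp ↦ ?_
    · obtain ⟨w, -, rfl⟩ := Finset.mem_image.mp hp
      exact (prime_natGenerator w).prime
    · obtain ⟨w, hw, rfl⟩ := Finset.mem_image.mp hp
      exact hn _ (prime_natGenerator w) (Finset.dvd_prod_of_mem (fun w ↦ natGenerator w) hw)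

end Data

/-! ### §2 ★¹⁰ The class theorem for the DROP rows -/

section Class

/-- ★¹⁰ **`stub_nonAdditive` (crux 19679 `DeepLowerAtThreeOffKatoStratum`) on the CLASS of depth-`1` rows WITH (ram) whose
Tamagawa `3` sits at a multiplicative prime, the additive places of Kodaira type `IV`/`IV*` (if any) having `f = 2`,
at ANY conductor — stub binders VERBATIM + «ordinary if good at `3`» + `Ram W₀ 3` + `v₃(∏ c_ℓ) ≤ 1` + `3 ∣ ∏ c_ℓ` +
«`3 ∤ c_p` at every `p² ∣ N`» + «`p³ ∤ N` at every additive place with `3 ∣ #Φ_p(𝔽̄_p)`» — from TEN NAMED FACTS and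
NOTHING ELSE**: `q` and `A` (§1), `D` and `M₁` (★⁸'s `exists_decomposition_exactlyDividing` on `N/(qA)` with
`P r := 3 ∣ ord_r Δ ∧ r² ∤ N`) are constructed from the curve, the level-lowered newform is the NEW named fact
`ribet1990_levelLowering_gamma0_newform_at_three_additiveDrop` (`hRk`) at the removed set `Dq` and the dropping set `A`,
and ★⁹ (`…MultiStabDepleteRows.stub_nonAdditive_ram_of_exists_levelLoweredNewform_deplete`) is applied. (With `A = 1`
this re-proves ★⁸'s class; the census class it ADDS is the 4 560 «DROP ∧ (ram)» rows of the seat's count.)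
[cite: DarmonDiamondTaylor1995, Thm. 3.15, Lemma 2.7 and Prop. 2.12] [cite: Diamond1995RefinedSerre, Thm. 6.4 and Cor. 6.5]
[cite: Ribet1990, Thm. 1.1] [cite: ColemanEdixhoven1998, Thm. 2.1] [cite: Vatsal1999, §1 (1.6), Thm. (1.13)]
[cite: GreenbergVatsal2000, §3 (17)–(19)] [cite: Ribet1984ICM, Thm. 4.1] [cite: Skinner2016PacificMC, Thm. C (§1)]
[cite: Mazur1978, Cor. 4.1] [cite: Kim2022StructureSelmer, Conj. 1.10 (PDF p. 8)]
[cite: SilvermanATAEC1994, Cor. IV.9.2 (d), Table 4.1, §IV.10, Prop. 10.3 (a)] -/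
theorem stub_nonAdditive_ram_tamagawaDepthOne_of_drop
    (hRk : ribet1990_levelLowering_gamma0_newform_at_three_additiveDrop)
    (hCE : colemanEdixhoven1998_heckePolynomial_simpleRoots)
    (hV : vatsal1999_plusSymbol_congruence) (hGV : greenbergVatsal2000_plusSymbol_congruence)
    (hI : ribet1984_iharaLemma)
    (hSk : Skinner2016.thmC_padicValRat_bsd_rank_zero)
    (hmod : hasEntireLFunction_rat) (hGZK : rank_eq_analyticRank_of_analyticRank_le_one)
    (hM : mazur_not_dvd_maninConstant_of_odd) :
    ∀ (W₀ : WeierstrassCurve ℚ) [W₀.IsElliptic] [W₀.IsGloballyMinimal],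
      (∀ n : ℕ, W₀.HasSurjectiveModNGaloisRep (3 ^ n : ℕ)) → Finite W₀.sha →
      ∀ {N : ℕ} [NeZero N], N = W₀.conductorNorm ℤ →
      ∀ (D₀ : ModularParametrizationData W₀ N),
        (∀ z ∈ D₀.L.lattice, ∃ w ∈ periodLattice D₀.f, z = D₀.c * w) →
        (∀ (W₂ : WeierstrassCurve ℚ) [W₂.IsElliptic] (D₂ : ModularParametrizationData W₂ N),
          D₂.f = D₀.f → D₀.modularDegree ≤ D₂.modularDegree) →
        (∀ r : ℚ, ratPlusSymbol D₀.f r ≠ 0 → 0 ≤ padicValRat 3 (ratPlusSymbol D₀.f r)) →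
        kuriharaVanishingOrder W₀ 3 D₀.f = 0 →
        ¬ (haveI : Fact (Nat.Prime 3) := ⟨Nat.prime_three⟩; Addv W₀ 3) →
        (W₀.HasGoodReductionAtPrime 3 → ¬ (3 : ℤ) ∣ W₀.frobeniusTrace 3) →
        (haveI : Fact (Nat.Prime 3) := ⟨Nat.prime_three⟩; Ram W₀ 3) →
        padicValNat 3 W₀.tamagawaProduct ≤ 1 → 3 ∣ W₀.tamagawaProduct →
        (∀ (p : ℕ) (hp : p.Prime), p ^ 2 ∣ N → ¬ 3 ∣ (haveI := Fact.mk hp; (W₀.baseChange ℚ_[p]).localTamagawaNumber ℤ_[p])) →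
        (∀ v : HeightOneSpectrum ℤ, W₀.HasAdditiveReductionAt v → 3 ∣ (W₀.kodairaSymbolAt v).componentGroupOrder →
          ¬ natGenerator v ^ 3 ∣ N) →
        ∃ d : ℕ, kuriharaPartialDeepInfty W₀ 3 D₀.f = d ∧
          kuriharaPartial W₀ 3 D₀.f 0 ≤
            ((padicValNat 3 (Nat.card (AddCommGroup.primaryComponent W₀.sha 3)) + d : ℕ) : ℕ∞) := by
  intro W₀ _ _ htower hfin N _ hN D₀ hopt hdeg hint hord hnA hordinary hram hv h3 hKc hK3
  have hsurj : W₀.HasSurjectiveModNGaloisRep 3 := by simpa using htower 1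
  have h9 : ¬ 3 ^ 2 ∣ N := hN ▸ not_sq_dvd_conductorNorm_of_not_addv W₀ hnA
  have hf := D₀.isNewformOf
  -- §1: the Tamagawa-`3` prime `q ∥ N` and the dropping set `A`
  obtain ⟨q, hqF, hqN, hqN2, hsplit, hqΔ⟩ :=
    exists_split_prime_of_three_dvd_tamagawaProduct_of_not_dvd_additive W₀ h3 (fun p hp hp2 ↦ hKc p hp (hN ▸ hp2))
  have hq : q.Prime := hqF.out
  obtain ⟨A, hAsq, hAadd, hAiff, hAdvd⟩ := exists_dropSet W₀
  rw [← hN] at hqN hqN2 hAadd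
  haveI : NeZero A := ⟨Squarefree.ne_zero hAsq⟩
  obtain ⟨N₁, hN₁⟩ := hqN
  have hN₁0 : N₁ ≠ 0 := fun h ↦ NeZero.ne N (by rw [hN₁, h, mul_zero])
  have hqN₁ : ¬ q ∣ N₁ := fun h ↦ hqN2 (by rw [pow_two, hN₁]; exact mul_dvd_mul_left q h)
  have hqA : ¬ q ∣ A := fun h ↦ hqN2 (hAadd q hq h)
  -- every prime of `A` is squared in `N = q N₁`, `q ∤ A`: `p² ∣ N₁`; hence `A ∣ N₁ = A N₂` and the primes of `A` divide `N₂`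
  have hAprime : ∀ p : ℕ, p.Prime → p ∣ A → p * p ∣ N₁ := by
    intro p hp hpA
    have hpq : p ≠ q := fun h ↦ hqA (h ▸ hpA)
    have h2 : p * p ∣ q * N₁ := by rw [← hN₁, ← pow_two]; exact hAadd p hp hpA
    exact (Nat.Coprime.mul_left ((Nat.coprime_primes hp hq).mpr hpq) ((Nat.coprime_primes hp hq).mpr hpq)).dvd_of_dvd_mul_left h2
  obtain ⟨N₂, hN₂⟩ : A ∣ N₁ := hAdvd N₁ fun p hp hpA ↦ (dvd_mul_right p p).trans (hAprime p hp hpA)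
  have hN₂0 : N₂ ≠ 0 := fun h ↦ hN₁0 (by rw [hN₂, h, mul_zero])
  have hAN₂ : ∀ p : ℕ, p.Prime → p ∣ A → p ∣ N₂ := by
    intro p hp hpA
    obtain ⟨A', hA'⟩ := hpA
    have hpA' : ¬ p ∣ A' := fun h ↦ by
      have : p * p ∣ A := by rw [hA']; exact mul_dvd_mul_left p h
      exact hp.ne_one (Nat.isUnit_iff.mp (hAsq p this))
    have h2 : p * p ∣ p * (A' * N₂) := by rw [← mul_assoc, ← hA', ← hN₂]; exact hAprime p hp ⟨A', hA'⟩
    have h3 : p ∣ A' * N₂ := Nat.dvd_of_mul_dvd_mul_left hp.pos h2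
    exact ((Nat.Prime.coprime_iff_not_dvd hp).mpr hpA').dvd_of_dvd_mul_left h3
  -- §2 of ★⁸: `N₂ = M₁·D`, `D` = the primes `r ∥ N` outside `A`, `q` with `3 ∣ ord_r Δ`
  obtain ⟨M₁, D, hMD, hDsq, hDM₁, hDP, hM₁P⟩ :=
    exists_decomposition_exactlyDividing hN₂0 (fun r ↦ (3 : ℤ) ∣ padicValRat r W₀.Δ ∧ ¬ r ^ 2 ∣ N)
  haveI : NeZero M₁ := ⟨fun h ↦ hN₂0 (by rw [← hMD, h, zero_mul])⟩
  have hNeq : M₁ * D * A * q = N := by rw [hMD, hN₁, hN₂]; ring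
  have hqMDA : ¬ q ∣ M₁ * D * A := by rw [hMD, mul_comm, ← hN₂]; exact hqN₁
  have hqM₁ : ¬ q ∣ M₁ := fun h ↦ hqMDA ((h.mul_right D).mul_right A)
  have hqD : ¬ q ∣ D := fun h ↦ hqMDA ((h.mul_left M₁).mul_right A)
  -- `D` is prime to `A` (its primes are `∥ N`), `A`-primes divide `M₁` exactly once
  have hDexact : ∀ p : ℕ, p.Prime → p ∣ D → ¬ p ^ 2 ∣ N := fun p hp hpD ↦ ((hDP p hp hpD).1).2
  have hAD : Nat.Coprime A D := by
    refine Nat.coprime_of_dvd fun p hp hpA hpD ↦ hDexact p hp hpD ?_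
    rw [← hNeq]; exact (hAadd p hp hpA).trans (by rw [hNeq])
  have hA : ∀ ℓ : ℕ, ℓ.Prime → ℓ ∣ A → ℓ ∣ M₁ ∧ ¬ ℓ ^ 2 ∣ M₁ ∧ cuspCoeff D₀.f ℓ = 0 := by
    intro ℓ hℓ hℓA
    haveI : Fact ℓ.Prime := ⟨hℓ⟩
    -- the place `v` of `ℤ` over `ℓ`: additive, with `3 ∣ #Φ_v`
    set v : HeightOneSpectrum ℤ := (primesEquiv (R := ℤ)).symm ⟨ℓ, hℓ⟩ with hvdef
    have hpv : primesEquiv v = ⟨ℓ, hℓ⟩ := (primesEquiv (R := ℤ)).apply_symm_apply ⟨ℓ, hℓ⟩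
    have hgen : natGenerator v = ℓ := congrArg Subtype.val hpv
    have hℓN2 : ℓ ^ 2 ∣ W₀.conductorNorm ℤ := hN ▸ hAadd ℓ hℓ hℓA
    have hadd : W₀.HasAdditiveReductionAt v := by
      rw [← natGenerator_sq_dvd_conductorNorm_iff v W₀, hgen]; exact hℓN2
    have h3Φ : 3 ∣ (W₀.kodairaSymbolAt v).componentGroupOrder := (hAiff v hadd).mpr (hgen ▸ hℓA)
    have hℓD : ¬ ℓ ∣ D := fun h ↦ hℓ.ne_one (Nat.dvd_one.mp (by
      have hg := Nat.dvd_gcd hℓA h; rwa [Nat.Coprime.gcd_eq_one hAD] at hg))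
    -- `ℓ ∣ N₂ = M₁ D`, `ℓ ∤ D` ⟹ `ℓ ∣ M₁`
    have hℓM₁ : ℓ ∣ M₁ :=
      ((Nat.Prime.coprime_iff_not_dvd hℓ).mpr hℓD).dvd_of_dvd_mul_right (by rw [hMD]; exact hAN₂ ℓ hℓ hℓA)
    -- `ℓ² ∣ M₁` would give `ℓ³ ∣ N`
    have hℓ2 : ¬ ℓ ^ 2 ∣ M₁ := by
      intro h
      refine hK3 v hadd h3Φ ?_
      rw [hgen, ← hNeq, pow_succ]
      exact (mul_dvd_mul h hℓA).trans ⟨D * q, by ring⟩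
    refine ⟨hℓM₁, hℓ2, ?_⟩
    -- `a_ℓ(f_E) = 0` at an additive `ℓ`
    have hng : ¬ W₀.HasGoodReductionAtPrime ℓ := fun hg ↦
      not_dvd_conductorNorm_of_hasGoodReductionAtPrime W₀ hg ((dvd_pow_self ℓ two_ne_zero).trans hℓN2)
    have hnm : ¬ W₀.HasMultiplicativeReductionAtPrime ℓ := fun hm ↦ by
      have key : ∀ r : Nat.Primes, primesEquiv v = r →
          (haveI := Fact.mk r.2; W₀.HasMultiplicativeReductionAtPrime (r : ℕ)) → W₀.HasMultiplicativeReductionAt v := by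
        rintro r rfl h'
        exact (hasMultiplicativeReductionAtPrime_primesEquiv_iff_hasMultiplicativeReductionAt W₀ v).mp h'
      exact (key ⟨ℓ, hℓ⟩ hpv hm).not_hasAdditiveReductionAt hadd
    rw [hf.2 ℓ, W₀.LFunction_apply_eq_zero_of_not_good_of_not_mult ℓ hng hnm (dvd_refl ℓ), Int.cast_zero]
  -- the signs `a_p(f) = ±1` at the (multiplicative) primes of `D`
  have hsign : ∀ p : ℕ, p.Prime → p ∣ D → ∃ u : ℤ, u * u = 1 ∧ cuspCoeff D₀.f p = u := by
    intro p hp hpD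
    haveI : Fact p.Prime := ⟨hp⟩
    have hpN : p ∣ W₀.conductorNorm ℤ := by
      rw [← hN, ← hNeq]
      exact ((hpD.mul_left M₁).mul_right A).mul_right q
    have hp2 : ¬ p ^ 2 ∣ W₀.conductorNorm ℤ := hN ▸ hDexact p hp hpD
    rcases hasGoodReductionAtPrime_or_hasMultiplicativeReductionAtPrime_of_not_sq_dvd_conductorNorm (V := W₀) hp2
      with hgood | hmult
    · exact absurd hpN (not_dvd_conductorNorm_of_hasGoodReductionAtPrime W₀ hgood)
    · by_cases hs : W₀.HasSplitMultiplicativeReductionAtPrime p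
      · refine ⟨1, by norm_num, ?_⟩
        rw [hf.2 p, W₀.LFunction_apply_prime_of_hasSplitMultiplicativeReductionAtPrime p hs]
      · refine ⟨-1, by norm_num, ?_⟩
        rw [hf.2 p, W₀.LFunction_apply_prime_of_hasMultiplicativeReductionAtPrime_of_not_split p hmult hs]
  -- the optimal-level newform from the additive-drop fact BY NAME (removed set `D q`, dropping set `A`)
  have hsqDq : Squarefree (D * q) :=
    (Nat.squarefree_mul ((Nat.Prime.coprime_iff_not_dvd hq).mpr hqD).symm).mpr ⟨hDsq, hq.prime.squarefree⟩
  have hcop : Nat.Coprime (D * q) (M₁ * A) := by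
    refine Nat.Coprime.mul_left (Nat.Coprime.mul_right hDM₁ hAD.symm) ?_
    exact (Nat.Prime.coprime_iff_not_dvd hq).mpr fun h ↦ by
      rcases (Nat.Prime.dvd_mul hq).mp h with h | h
      · exact hqM₁ h
      · exact hqA h
  have hDqΔ : ∀ r : ℕ, r.Prime → r ∣ D * q → (3 : ℤ) ∣ padicValRat r W₀.Δ := by
    intro r hr hrDq
    rcases (Nat.Prime.dvd_mul hr).mp hrDq with h | h
    · exact (hDP r hr h).1.1
    · rw [(Nat.prime_dvd_prime_iff_eq hr hq).mp h]; exact hqΔ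
  have hM₁Δ' : ∀ p : ℕ, p.Prime → p ∣ M₁ → ¬ p ^ 2 ∣ N → ¬ (3 : ℤ) ∣ padicValRat p W₀.Δ := by
    intro p hp hpM hp2 h3
    refine hM₁P p hp hpM (fun hp2' ↦ hp2 ?_) ⟨h3, hp2⟩
    rw [← hNeq, hMD]
    exact (hp2'.mul_right A).mul_right q
  have hM₁Δ : ∀ p : ℕ, p.Prime → p ∣ M₁ → ¬ p ^ 2 ∣ N → p ≠ 3 → ¬ (3 : ℤ) ∣ padicValRat p W₀.Δ :=
    fun p hp hpM hp2 _ ↦ hM₁Δ' p hp hpM hp2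
  have h3Δ : 3 ∣ M₁ → ¬ (3 : ℤ) ∣ padicValRat 3 W₀.Δ := fun h3M ↦ hM₁Δ' 3 Nat.prime_three h3M h9
  have hex : ∀ ι : PadicAlgCl 3 ≃+* ℂ, ∃ g : CuspForm (Gamma0 M₁) 2, IsNewform0 g ∧
      (∀ p : ℕ, p.Prime → ¬ p ∣ D * q * A → Valued.v (ι.symm (cuspCoeff D₀.f p - cuspCoeff g p)) < 1) ∧
      (∀ p : ℕ, p.Prime → p ∣ D * q → Valued.v (ι.symm (cuspCoeff g p - cuspCoeff D₀.f p * (p + 1))) < 1) :=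
    fun ι ↦ hRk W₀ hsurj (N := N) (M₁ := M₁) (A := A) (D := D * q) (by rw [← hNeq]; ring) hsqDq hAsq hcop h9 hN hDqΔ hM₁Δ
      h3Δ (fun p hp hpA ↦ hAadd p hp hpA) hAiff D₀ ι
  exact stub_nonAdditive_ram_of_exists_levelLoweredNewform_deplete hCE hV hGV hI hSk hmod hGZK hM W₀ htower hfin hN D₀
    hopt hdeg hint hord hnA hordinary hram hv hNeq hsplit hqMDA hDsq hDM₁ hAsq hAD hA hsign hex

end Class

end Summit.BirchSwinnertonDyer.BirchSwinnertonDyer.Theorems.KimAtThreeDeepLowerOffStratumLevelLoweringMultiStabDepleteRowsClass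

end
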